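import Summits.QuantumFields.YangMills.Theorems.IR.BlockedActivityCalibration
import Summits.QuantumFields.YangMills.Theorems.IR.BlockedActivityTyp
import Summits.QuantumFields.YangMills.Theorems.BalabanLadderIRUnivShellCondSmallBeta
import Literature.MathematicalPhysics.QuantumLattice.LatticeGaugeDLRProofs
import HarnessLib

/-!
# Crux `IR` (stmt-QuantumFields-19354), lane B «strong coupling AFTER BLOCKING»: the REPAIRED W-CURRENCY (window-indexed reference) and its
# reductions — owner R103 (b) ∕ R106 (1), after ctriage-1's O-112 (part 1/2: class, reductions, calibration)

Helper module for item `stmt-QuantumFields-19354` (`--supports`; it closes nothing), lane `ym-19354-onsetsc-p2`.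

WHY.  The lane's first currency `BlockedRep`∕`BlockedActivityClass` (p527934) has a σ-INDEPENDENT reference, so its reduction
(`univShellCond_of_blockedActivity`, p528785) bounds `|E_σ f − E_σ' f|` for ALL pairs of exterior data — the agreement hypothesis of
`UnivShellCond` was never used.  ctriage-1's O-112 (owner R103): the central point-gauge flip at a boundary site of the region `Y = {0}` is such a
pair, sends a single-edge centre observable `f ↦ 1 − f` (DLR gauge covariance) and so forces the boundary plaquette small on every odd torus,
contradicting the AF plaquette moments at large `β`: `BlockedActivityOnsetAt r.ρ` is FALSE AS TYPED for `SU(2)` fundamental — CLASS MISSTATED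
(the reduction is fine).  The σ-uniform onset statements `BlockedActivityOnsetSC`, `…OnsetCalSC`, `…TypOnsetCalSC`, `…WorkingClassCalSC` of
p527934 ∕ p533919 ∕ p534686 are therefore SUPERSEDED as onset currencies (Negative file: disprove-1, `Theorems/IR/Negative/BlockedActivityOnsetFalse`).

THE REPAIR (R103 (b)), typed by REUSING the landed relativised structure `BlockedRepOn` (p532761): the reference `(Ω_τ, μ_τ, obs_τ, g_τ)` may
depend on the WINDOW DATUM `τ` — the exterior datum on `Tempered.collarEdges w n Y` (edges of the `n`-window cells outside `Y`) — and on nothing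
else: `BlockedActivityClassW ρ β b n a := ∀ frame, ∀ Y, ∀ τ, Nonempty (BlockedRepOn ρ β w Y a (WindowAgree w n Y τ))`; with the typical class:
`BlockedActivityTypW … Typ` (`S = WindowAgree ∩ TypicalOff`, W and W|Typ together, R103 (iii)), `BlockedActivityTypWAll` (every centre).
* §0 self-check (R103 (b)(i)) `integral_ymSpecification_gaugeTransformZd_of_trivial_on_centre`: a gauge transformation trivial at the centre cell's
  sites does not move centre expectations, whatever it does elsewhere (tree `ymSpecification_map_gaugeTransformZd_holds`).
* §2 REDUCTIONS re-proved for W — legitimately now: the pairs compared by `UnivShellCond` ∕ `ClauseI` agree on the window cells off `Y`, i.e. lie in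
  ONE agreement class (`mem_windowAgree_of_agree`; the flip pair does not): **`univShellCond_of_blockedActivityW`**, **`clauseI_of_blockedActivityTypW`**,
  `…_radiusT`, `clauseIAll_of_blockedActivityTypWAll_radiusT` (the `hadapt` of cplan (6d)), (the SHARP forms at `radiusKP ε` are in part 2/2); transfers old ⇒ W (`blockedActivityClassW_of_blockedActivityClass`,
  `blockedActivityTypW_of_blockedActivityTyp`, `blockedActivityTypW_of_blockedActivityClassW`, `BlockedRepOn.mono`).
* §3 the small-`β` CALIBRATION transfers verbatim: `blockedActivityClassW_one_of_smallBeta` (p531838).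
Part 2/2 (`Theorems/IR/BlockedActivityWOnset`): the onset ∕ construction statements in W-currency and their targets by name.

HONEST FRAMING: repair of a misstated (unregistered) lane currency + reductions among OPEN statements of a CONDITIONAL chain; no blocked-activity
bound is claimed for Yang–Mills at any `β > β_B`; not mixing, not a gap, not Clay.  No `sorry`; axioms ⊆ {propext, Classical.choice, Quot.sound}.
-/

set_option autoImplicit false

noncomputable section

open Filter Topology MeasureTheory
open Literature.MathematicalPhysics.QuantumFieldTheory Literature.MathematicalPhysics.QuantumLattice
open Literature.Probability.LatticeModels (IsLocalPerturbation)
open Summit.QuantumFields.YangMills.Cruxes.OSLegsFromFemtoAndGap.DlrCollarTransfer (LowerBounds)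
open Summit.QuantumFields.YangMills.Cruxes.IR.Tempered (cellEdges windowCells regionEdges collarEdges)
open Summit.QuantumFields.YangMills.Cruxes.IR.ShellTempered (windowCellsPlus)
open Summit.QuantumFields.YangMills.Cruxes.IR.OnsetFormats (shellCount UnivShellCond)
open Summit.QuantumFields.YangMills.Cruxes.IR.OnsetFormatsUc (OnsetMixingTypicalUKPcSC)
open Summit.QuantumFields.YangMills.Cruxes.IR.FixedMesh (ClauseI)
open Summit.QuantumFields.YangMills.Cruxes.IR.AfPincerUc (ClauseIAll IsFrame TypLocal ClauseIIukp ClauseIII)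
open Summit.QuantumFields.YangMills.Cruxes.IR.CellTempered.Engine (shiftFrame)
open Summit.QuantumFields.YangMills.Theorems.IRTypLocalExcess (WorkingClass)
open Summit.QuantumFields.YangMills.Cruxes.IR.AfPincerUc.Supplier (SupCellRarityAt)

namespace Summit.QuantumFields.YangMills.Cruxes.IR.BlockedActivity

/-! ## §0 Self-check (R103 (b)(i)): gauge transformations trivial at the centre cell's sites do not move centre expectations -/

section Gauge

variable {G : Type} [Group G] [TopologicalSpace G] [IsTopologicalGroup G] [CompactSpace G]
  [MeasurableSpace G] [BorelSpace G] [SecondCountableTopology G] {N : ℕ} {ρ : G →* Matrix (Fin N) (Fin N) ℂ}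

/-- **`rep_invariant_of_exteriorGauge`** (DLR gauge covariance, tree `ymSpecification_map_gaugeTransformZd_holds`): a gauge transformation `g`
that is trivial at both endpoints of every edge of the centre cell does not change the kernel expectation of any centre observable — whatever
it does elsewhere (inside or outside the window).  In particular O-112's central flip, which is NON-trivial at a boundary site of the centre
cell, is the only kind of boundary gauge move a centre observable can see. -/
theorem integral_ymSpecification_gaugeTransformZd_of_trivial_on_centre (hρ : Continuous ρ) (β : ℝ)
    (Λ : Finset (Literature.MathematicalPhysics.QuantumLattice.ZdEdge 4)) (σ : LGConfig 4 G) (g : (Fin 4 → ℤ) → G) (w : Fin 4 → ℤ → ℤ)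
    (hg : ∀ e ∈ cellEdges w 0, g e.1 = 1 ∧ g (e.1 + Pi.single e.2 1) = 1)
    {f : LGConfig 4 G → ℝ} (hf : IsCylinder f (cellEdges w 0)) (hfm : Measurable f) :
    ∫ U, f U ∂(ymSpecification ρ β Λ (gaugeTransformZd g σ)) = ∫ U, f U ∂(ymSpecification ρ β Λ σ) := by
  rw [← ymSpecification_map_gaugeTransformZd_holds ρ hρ β Λ σ g,
    integral_map (measurable_gaugeTransformZd g).aemeasurable hfm.aestronglyMeasurable]
  refine integral_congr_ae (Filter.Eventually.of_forall fun U => hf fun e he => ?_)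
  obtain ⟨h1, h2⟩ := hg e he
  simp [gaugeTransformZd, h1, h2]

end Gauge

/-! ## §1 The W-currency: window-indexed reference (definitions) -/

section Defs

variable {G : Type} [Group G] [TopologicalSpace G] [IsTopologicalGroup G] [CompactSpace G]
  [MeasurableSpace G] [BorelSpace G]

/-- The AGREEMENT CLASS of the window datum `τ` off the region `Y`: exterior data equal to `τ` on the collar `collarEdges w n Y` (the edges of
the `n`-window cells outside `Y` — exactly the agreement hypothesis of `OnsetFormats.UnivShellCond` ∕ `FixedMesh.ClauseI`). -/
def WindowAgree (w : Fin 4 → ℤ → ℤ) (n : ℕ) (Y : Finset Cell) (τ : LGConfig 4 G) : Set (LGConfig 4 G) :=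
  {σ | ∀ e ∈ collarEdges w n Y, σ e = τ e}

/-- **The blocked-activity class, W-currency** (owner R103 (b): WINDOW-INDEXED reference).  On every mesh-`b` frame, for every cell region `Y`
of the `n`-window containing the centre and EVERY window datum `τ`, the kernel admits a blocked local-perturbation representation of radius `a`
RELATIVE to the agreement class of `τ` — the reference `(Ω_τ, μ_τ, obs_τ, g_τ)` may depend on `τ` and on nothing else of the exterior datum.
Supersedes `BlockedActivityClass` (σ-INDEPENDENT reference, p527934), which is refuted as an onset currency at weak coupling by ctriage-1's
O-112 (central point-gauge flip at a boundary site of `Y = {0}`: `f ↦ 1 − f` on a single-edge centre observable; Negative file by disprove-1). -/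
def BlockedActivityClassW {N : ℕ} (ρ : G →* Matrix (Fin N) (Fin N) ℂ) (β : ℝ) (b n : ℕ) (a : ℝ) : Prop :=
  ∀ w : Fin 4 → ℤ → ℤ, (∀ i j, w i j + ((b : ℕ) : ℤ) ≤ w i (j + 1) ∧ w i (j + 1) ≤ w i j + 2 * ((b : ℕ) : ℤ)) →
    ∀ Y : Finset Cell, Y ⊆ windowCells n → (0 : Cell) ∈ Y →
      ∀ τ : LGConfig 4 G, Nonempty (BlockedRepOn ρ β w Y a (WindowAgree w n Y τ))

/-- **The Typ-relativised class, W-currency, at ONE frame**: representation relative to «agrees with `τ` on the collar AND typical off `Y`». -/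
def BlockedActivityTypW {N : ℕ} (ρ : G →* Matrix (Fin N) (Fin N) ℂ) (β : ℝ) (w : Fin 4 → ℤ → ℤ) (n : ℕ) (a : ℝ)
    (Typ : Cell → Set (LGConfig 4 G)) : Prop :=
  ∀ Y : Finset Cell, Y ⊆ windowCells n → (0 : Cell) ∈ Y →
    ∀ τ : LGConfig 4 G, Nonempty (BlockedRepOn ρ β w Y a (WindowAgree w n Y τ ∩ TypicalOff n Y Typ))

/-- … at every centre (shifted frames, re-indexed class): the `Act` of cplan's (6d) in W-currency. -/
def BlockedActivityTypWAll {N : ℕ} (ρ : G →* Matrix (Fin N) (Fin N) ℂ) (β : ℝ) (w : Fin 4 → ℤ → ℤ) (n : ℕ) (a : ℝ)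
    (Typ : Cell → Set (LGConfig 4 G)) : Prop :=
  ∀ c₀ : Cell, BlockedActivityTypW ρ β (shiftFrame w c₀) n a (fun c => Typ (c + c₀))

/-- **Blocked-activity onset at `(G, ρ)`, W-currency** (uncalibrated): every radius `a > 0` is met at window `1` by some mesh `b ≥ 1`, at all large `β`. -/
def BlockedActivityOnsetAtW {N : ℕ} (ρ : G →* Matrix (Fin N) (Fin N) ℂ) : Prop :=
  ∀ a : ℝ, 0 < a → ∃ β₂ : ℝ, ∀ β : ℝ, β₂ ≤ β → ∃ b : ℕ, 1 ≤ b ∧ BlockedActivityClassW ρ β b 1 a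

end Defs

/-! ## §2 The reductions re-proved for W (the compared pairs lie in ONE agreement class) -/

section Reductions

variable {G : Type} [Group G] [TopologicalSpace G] [IsTopologicalGroup G] [CompactSpace G]
  [MeasurableSpace G] [BorelSpace G] {N : ℕ} {ρ : G →* Matrix (Fin N) (Fin N) ℂ} {β : ℝ}
  {w : Fin 4 → ℤ → ℤ} {Y : Finset Cell} {a ε : ℝ} {n : ℕ}


omit [Group G] [TopologicalSpace G] [IsTopologicalGroup G] [CompactSpace G] [MeasurableSpace G] [BorelSpace G] in
/-- **The agreement hypothesis of (i) ∕ `UnivShellCond` puts the pair in ONE agreement class**: if `σ, σ'` agree on the edges of the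
window cells off `Y`, then `σ'` agrees with `σ` on `collarEdges w n Y`. -/
theorem mem_windowAgree_of_agree {σ σ' : LGConfig 4 G}
    (hagree : ∀ c ∈ windowCellsPlus n, c ∉ Y → c ∈ windowCells n → ∀ e ∈ cellEdges w c, σ e = σ' e) :
    σ' ∈ WindowAgree w n Y σ := by
  intro e he
  simp only [Summit.QuantumFields.YangMills.Cruxes.IR.Tempered.collarEdges, Finset.mem_sdiff,
    Summit.QuantumFields.YangMills.Cruxes.IR.Tempered.regionEdges, Finset.mem_biUnion, not_exists, not_and] at he
  obtain ⟨⟨c, hc, hec⟩, hnot⟩ := he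
  have hcY : c ∉ Y := fun hcY => hnot c hcY hec
  exact (hagree c (AfPincerUc.Calibration.windowCells_subset_windowCellsPlus n hc) hcY hc e hec).symm

omit [Group G] [TopologicalSpace G] [IsTopologicalGroup G] [CompactSpace G] [MeasurableSpace G] [BorelSpace G] in
/-- Every datum lies in its own agreement class. -/
theorem mem_windowAgree_self (σ : LGConfig 4 G) : σ ∈ WindowAgree w n Y σ := fun _ _ => rfl

omit [TopologicalSpace G] [IsTopologicalGroup G] [CompactSpace G] [MeasurableSpace G] [BorelSpace G] in
/-- Smallness at `a ≤ a(ε)`, `ε ≤ 1` (the three inequalities of `univShellCond_of_blockedActivity`). -/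
theorem smallness_of_le_radius (hε1 : ε ≤ 1) (haε : a ≤ radius ε) :
    Real.exp 1 * a * ((81 : ℝ) + 1) ^ 2 ≤ 1 / 2 ∧ Real.exp 1 * a * 2 ^ 81 ≤ 1 ∧
      4 * Real.exp 1 * a * 2 ^ 81 * (2 * Real.exp 1) ^ 82 ≤ ε := by
  obtain ⟨h1, h2, h3⟩ := smallness_radius hε1
  have he := (Real.exp_pos 1).le
  refine ⟨?_, ?_, ?_⟩
  · exact (mul_le_mul_of_nonneg_right (mul_le_mul_of_nonneg_left haε he) (by positivity)).trans h1
  · exact (mul_le_mul_of_nonneg_right (mul_le_mul_of_nonneg_left haε he) (by positivity)).trans h2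
  · calc 4 * Real.exp 1 * a * 2 ^ 81 * (2 * Real.exp 1) ^ 82
        ≤ 4 * Real.exp 1 * radius ε * 2 ^ 81 * (2 * Real.exp 1) ^ 82 := by gcongr
      _ ≤ ε := h3

/-- A representation relative to `S` restricts to every `S' ⊆ S`. -/
def BlockedRepOn.mono {S S' : Set (LGConfig 4 G)} (R : BlockedRepOn ρ β w Y a S) (h : S' ⊆ S) : BlockedRepOn ρ β w Y a S' where
  Ω := R.Ω
  mΩ := R.mΩ
  μ := R.μ
  isProb := R.isProb
  𝓕 := R.𝓕
  C := R.C
  g := R.g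
  obs := R.obs
  perturbation := fun σ hσ => R.perturbation σ (h hσ)
  obs_local := R.obs_local
  rep := fun σ hσ => R.rep σ (h hσ)

/-- **W-reduction**: the W-class at radius `a ≤ a(ε)` (`ε ≤ 1`) gives `OnsetFormats.UnivShellCond ρ β b n ε` — VERBATIM the proof of
`univShellCond_of_blockedActivity`, now legitimately: the two compared data agree on the window cells off `Y`, hence lie in ONE agreement class. -/
theorem univShellCond_of_blockedActivityW {b : ℕ} (hC : BlockedActivityClassW ρ β b n a) (hε1 : ε ≤ 1) (haε : a ≤ radius ε) :
    UnivShellCond ρ β b n ε := by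
  intro w hw Y hY h0 σ σ' hagree f hf hfm hf01
  obtain ⟨R⟩ := hC w hw Y hY h0 σ
  have hσ : σ ∈ WindowAgree w n Y σ := mem_windowAgree_self σ
  have hσ' : σ' ∈ WindowAgree w n Y σ := mem_windowAgree_of_agree hagree
  obtain ⟨h1, h2, h3⟩ := smallness_of_le_radius hε1 haε
  exact (R.abs_integral_sub_integral_le h1 h2 hσ hσ' ⟨hf, hfm, hf01⟩).trans h3

/-- **W|Typ-reduction**: `BlockedActivityTypW ρ β w n a Typ → ε ≤ 1 → a ≤ radius ε → FixedMesh.ClauseI ρ β w n ε Typ`. -/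
theorem clauseI_of_blockedActivityTypW {Typ : Cell → Set (LGConfig 4 G)} (hC : BlockedActivityTypW ρ β w n a Typ)
    (hε1 : ε ≤ 1) (haε : a ≤ radius ε) : ClauseI ρ β w n ε Typ := by
  intro Y hY h0 σ σ' htyp hagree f hf hfm hf01
  obtain ⟨R⟩ := hC Y hY h0 σ
  have hσ : σ ∈ WindowAgree w n Y σ ∩ TypicalOff n Y Typ := ⟨mem_windowAgree_self σ, fun c hc hcY => (htyp c hc hcY).1⟩
  have hσ' : σ' ∈ WindowAgree w n Y σ ∩ TypicalOff n Y Typ := ⟨mem_windowAgree_of_agree hagree, fun c hc hcY => (htyp c hc hcY).2⟩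
  obtain ⟨h1, h2, h3⟩ := smallness_of_le_radius hε1 haε
  exact (R.abs_integral_sub_integral_le h1 h2 hσ hσ' ⟨hf, hfm, hf01⟩).trans h3

/-- Total single-frame form (`radiusT`). -/
theorem clauseI_of_blockedActivityTypW_radiusT {Typ : Cell → Set (LGConfig 4 G)}
    (hC : BlockedActivityTypW ρ β w n (radiusT ε) Typ) : ClauseI ρ β w n ε Typ :=
  clauseI_mono (min_le_left ε 1) (clauseI_of_blockedActivityTypW hC (min_le_right ε 1) le_rfl)

/-- Every centre, total form — the `hadapt` of cplan's (6d) in W-currency. -/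
theorem clauseIAll_of_blockedActivityTypWAll_radiusT {Typ : Cell → Set (LGConfig 4 G)}
    (hC : BlockedActivityTypWAll ρ β w n (radiusT ε) Typ) : ClauseIAll ρ β w n ε Typ :=
  fun c₀ => clauseI_of_blockedActivityTypW_radiusT (hC c₀)

/-- The OLD σ-uniform class implies the W-class (so everything proved FOR the old class — e.g. the small-`β` calibration — transfers). -/
theorem blockedActivityClassW_of_blockedActivityClass {b : ℕ} (hC : BlockedActivityClass ρ β b n a) : BlockedActivityClassW ρ β b n a :=
  fun w hw Y hY h0 _ => by
    obtain ⟨R⟩ := hC w hw Y hY h0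
    exact ⟨blockedRepOn_of_blockedRep R _⟩

/-- The old relativised class implies the W|Typ class. -/
theorem blockedActivityTypW_of_blockedActivityTyp {Typ : Cell → Set (LGConfig 4 G)} (hC : BlockedActivityTyp ρ β w n a Typ) :
    BlockedActivityTypW ρ β w n a Typ := fun Y hY h0 _ => by
  obtain ⟨R⟩ := hC Y hY h0
  exact ⟨R.mono Set.inter_subset_right⟩

/-- The W-class implies the W|Typ class at that frame, for every `Typ`. -/
theorem blockedActivityTypW_of_blockedActivityClassW {b : ℕ} (hC : BlockedActivityClassW ρ β b n a) (hw : IsFrame b w)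
    (Typ : Cell → Set (LGConfig 4 G)) : BlockedActivityTypW ρ β w n a Typ := fun Y hY h0 τ => by
  obtain ⟨R⟩ := hC w hw Y hY h0 τ
  exact ⟨R.mono Set.inter_subset_left⟩

end Reductions

/-! ## §3 Strong coupling: the calibration transfers to W -/

section Calibration

variable {G : Type} [Group G] [TopologicalSpace G] [IsTopologicalGroup G] [CompactSpace G]
  [MeasurableSpace G] [BorelSpace G] {N : ℕ} (ρ : G →* Matrix (Fin N) (Fin N) ℂ)

/-- **Strong coupling BEFORE blocking instantiates the W-class at mesh `1`** (from `blockedActivityClass_one_of_smallBeta`, p531838). -/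
theorem blockedActivityClassW_one_of_smallBeta (hρ : Continuous ρ) {a : ℝ} (ha : 0 < a) :
    ∃ β_B : ℝ, 0 < β_B ∧ ∀ β : ℝ, |β| ≤ β_B → ∀ n : ℕ, BlockedActivityClassW ρ β 1 n a := by
  obtain ⟨β_B, hB, h⟩ := blockedActivityClass_one_of_smallBeta ρ hρ ha
  exact ⟨β_B, hB, fun β hβ n => blockedActivityClassW_of_blockedActivityClass (h β hβ n)⟩

end Calibration

end Summit.QuantumFields.YangMills.Cruxes.IR.BlockedActivity

end
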